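import Literature.Analysis.FluidPDE.CompressibleEulerImplosionODEMaximal
import Literature.Analysis.FluidPDE.CompressibleEulerImplosionODEEscape
import Literature.Analysis.FluidPDE.CompressibleEulerImplosionTriangle
import Literature.Analysis.ODE.MaximalTime
import HarnessLib

/-!
# Graph-channel pieces for a planar `C¹` vector field (the barrier principle of §§3–4, quantified)

Topic `Literature/Analysis/FluidPDE`; namespace
`Literature.Analysis.FluidPDE.BuckmasterCaolaboraGomezserrano2025.ODE`. Support file for the
certificate discharging the computer-assisted Propositions 3.1 and 4.1 of T. Buckmaster,
G. Cao-Labora, J. Gómez-Serrano, *Smooth imploding solutions for 3D compressible fluids*, Forum Math.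
Pi 13 (2025) e6, arXiv:2208.09445, at `γ = 5/3`. The paper confines the smooth branch through
`P_s` by BARRIERS: curves along which the (desingularised, polynomial) field has a normal component
of a fixed sign, so that trajectories cannot cross them (§3, proof of Prop. 3.1: "It cannot exit `𝒯`
through `b^nl(t)`, `b^fl(t)` … due to Proposition 3.5 …"; §4 likewise with `b^nr`, `B^fr`). This file
proves the elementary real-analysis statement behind one such step, in the form used by our
certificate: a **graph-channel piece**.

Fix a linear chart `u = aW + cZ`, `v = bW + dZ` (`ad − bc ≠ 0`) of the plane, an interval
`[u_a, u_b]` and two differentiable functions `f_R < f_L` on it. The piece is the compact set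
`K = {u ∈ [u_a, u_b], f_R(u) ≤ v ≤ f_L(u)}`. Hypotheses on the `C¹` field `F`: on the upper wall
`v = f_L(u)` the field crosses downwards (`v̇ − f_L′(u) u̇ < 0`), on the lower wall upwards, and
`u̇ > 0` on `K` (`u̇ = a F_W + c F_Z`, `v̇ = b F_W + d F_Z`). Conclusion
(`exists_exit_of_piece`): the solution of `x′ = F(x)` issued from any point of `K` strictly between
the walls and with `u < u_b` exists until it reaches the exit face `u = u_b`, stays strictly between
the walls, and reaches that face in finite time. Proof: local existence and maximal continuation
(`ODE.exists_maximal`), the multi-barrier trapping lemma (`ODE.forall_le_zero_of_deriv_neg`), the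
escape lemma (`ODE.eventually_not_mem_of_maximal`) and the maximal-time bookkeeping of
`Literature.Analysis.ODE.maximalTimeP`. Theorems only; no facts.
[cite: BuckmasterCaolaboraGomezserrano2025, §3 (proof of Prop. 3.1), §4 (proof of Prop. 4.1)]
-/

noncomputable section

open Set Filter Metric Topology

namespace Literature.Analysis.FluidPDE

namespace BuckmasterCaolaboraGomezserrano2025

namespace ODE

open Literature.Analysis.ODE

/-- A linear chart of the plane: `u = aW + cZ`, `v = bW + dZ`. [folklore] -/
structure LinChart where
  /-- coefficient of the first coordinate in `u` -/
  a : ℝ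
  /-- coefficient of the second coordinate in `u` -/
  c : ℝ
  /-- coefficient of the first coordinate in `v` -/
  b : ℝ
  /-- coefficient of the second coordinate in `v` -/
  d : ℝ

namespace LinChart

variable (ch : LinChart)

/-- The coordinate `u = aW + cZ`. [folklore] -/
def u (p : ℝ × ℝ) : ℝ := ch.a * p.1 + ch.c * p.2

/-- The coordinate `v = bW + dZ`. [folklore] -/
def v (p : ℝ × ℝ) : ℝ := ch.b * p.1 + ch.d * p.2

/-- [folklore] -/
theorem continuous_u : Continuous ch.u := by
  unfold u; fun_prop

/-- [folklore] -/
theorem continuous_v : Continuous ch.v := by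
  unfold v; fun_prop

/-- Along a curve, `u` has derivative `u(velocity)`. [folklore] -/
theorem hasDerivAt_u {x : ℝ → ℝ × ℝ} {x' : ℝ × ℝ} {t : ℝ} (hx : HasDerivAt x x' t) :
    HasDerivAt (fun s => ch.u (x s)) (ch.u x') t := by
  have h1 : HasDerivAt (fun s => (x s).1) x'.1 t := hx.fst
  have h2 : HasDerivAt (fun s => (x s).2) x'.2 t := hx.snd
  unfold u
  exact (h1.const_mul ch.a).add (h2.const_mul ch.c)

/-- Along a curve, `v` has derivative `v(velocity)`. [folklore] -/
theorem hasDerivAt_v {x : ℝ → ℝ × ℝ} {x' : ℝ × ℝ} {t : ℝ} (hx : HasDerivAt x x' t) :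
    HasDerivAt (fun s => ch.v (x s)) (ch.v x') t := by
  have h1 : HasDerivAt (fun s => (x s).1) x'.1 t := hx.fst
  have h2 : HasDerivAt (fun s => (x s).2) x'.2 t := hx.snd
  unfold v
  exact (h1.const_mul ch.b).add (h2.const_mul ch.d)

/-- With `ad − bc ≠ 0` the chart controls the point: `|W|, |Z| ≤ C (|u| + |v|)`. [folklore] -/
theorem norm_le_of_det_ne {ch : LinChart} (hdet : ch.a * ch.d - ch.b * ch.c ≠ 0) (p : ℝ × ℝ) :
    ‖p‖ ≤ (|ch.a| + |ch.b| + |ch.c| + |ch.d|) / |ch.a * ch.d - ch.b * ch.c| * (|ch.u p| + |ch.v p|) := by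
  set D := ch.a * ch.d - ch.b * ch.c with hD
  have hDpos : 0 < |D| := abs_pos.mpr hdet
  have e1 : p.1 * D = ch.d * ch.u p - ch.c * ch.v p := by unfold u v; simp only [hD]; ring
  have e2 : p.2 * D = -ch.b * ch.u p + ch.a * ch.v p := by unfold u v; simp only [hD]; ring
  have h1 : |p.1| * |D| ≤ (|ch.d| + |ch.c|) * (|ch.u p| + |ch.v p|) := by
    rw [← abs_mul, e1]
    calc |ch.d * ch.u p - ch.c * ch.v p| ≤ |ch.d * ch.u p| + |ch.c * ch.v p| := abs_sub _ _
      _ = |ch.d| * |ch.u p| + |ch.c| * |ch.v p| := by rw [abs_mul, abs_mul]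
      _ ≤ (|ch.d| + |ch.c|) * (|ch.u p| + |ch.v p|) := by
          nlinarith [abs_nonneg ch.d, abs_nonneg ch.c, abs_nonneg (ch.u p), abs_nonneg (ch.v p)]
  have h2 : |p.2| * |D| ≤ (|ch.b| + |ch.a|) * (|ch.u p| + |ch.v p|) := by
    rw [← abs_mul, e2]
    calc |-ch.b * ch.u p + ch.a * ch.v p| ≤ |-ch.b * ch.u p| + |ch.a * ch.v p| := abs_add_le _ _
      _ = |ch.b| * |ch.u p| + |ch.a| * |ch.v p| := by rw [abs_mul, abs_mul, abs_neg]
      _ ≤ (|ch.b| + |ch.a|) * (|ch.u p| + |ch.v p|) := by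
          nlinarith [abs_nonneg ch.b, abs_nonneg ch.a, abs_nonneg (ch.u p), abs_nonneg (ch.v p)]
  have hn : ‖p‖ = max |p.1| |p.2| := by
    rw [Prod.norm_def, Real.norm_eq_abs, Real.norm_eq_abs]
  rw [hn, div_mul_eq_mul_div, le_div_iff₀ hDpos]
  have hs : 0 ≤ |ch.u p| + |ch.v p| := by positivity
  rcases le_total |p.1| |p.2| with h | h
  · rw [max_eq_right h]
    nlinarith [abs_nonneg ch.a, abs_nonneg ch.b, abs_nonneg ch.c, abs_nonneg ch.d]
  · rw [max_eq_left h]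
    nlinarith [abs_nonneg ch.a, abs_nonneg ch.b, abs_nonneg ch.c, abs_nonneg ch.d]

end LinChart

/-- The compact **piece** `{u ∈ [u_a, u_b], f_R(u) ≤ v ≤ f_L(u)}`. [folklore] -/
def piece (ch : LinChart) (ua ub : ℝ) (fL fR : ℝ → ℝ) : Set (ℝ × ℝ) :=
  {p | ch.u p ∈ Icc ua ub ∧ fR (ch.u p) ≤ ch.v p ∧ ch.v p ≤ fL (ch.u p)}

/-- [folklore] -/
theorem isClosed_piece (ch : LinChart) (ua ub : ℝ) {fL fR : ℝ → ℝ} (hfL : Continuous fL)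
    (hfR : Continuous fR) : IsClosed (piece ch ua ub fL fR) := by
  have hu := ch.continuous_u
  have hv := ch.continuous_v
  refine (isClosed_Icc.preimage hu).inter ((isClosed_le (hfR.comp hu) hv).inter
    (isClosed_le hv (hfL.comp hu)))

/-- The piece is compact when `ad − bc ≠ 0`. [folklore] -/
theorem isCompact_piece {ch : LinChart} (hdet : ch.a * ch.d - ch.b * ch.c ≠ 0) {ua ub : ℝ}
    {fL fR : ℝ → ℝ} (hfL : Continuous fL) (hfR : Continuous fR) :
    IsCompact (piece ch ua ub fL fR) := by
  -- bounded: `|v| ≤ M` with `M` from the extreme values of `f_L`, `f_R` on `[u_a, u_b]`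
  obtain ⟨ML, hML⟩ := isCompact_Icc.bddAbove_image (f := fL) (hfL.continuousOn (s := Icc ua ub))
  obtain ⟨mR, hmR⟩ := isCompact_Icc.bddBelow_image (f := fR) (hfR.continuousOn (s := Icc ua ub))
  set C := (|ch.a| + |ch.b| + |ch.c| + |ch.d|) / |ch.a * ch.d - ch.b * ch.c| with hC
  have hC0 : 0 ≤ C := by simp only [hC]; positivity
  set R := C * ((|ua| + |ub|) + (|ML| + |mR|)) with hR
  refine Metric.isCompact_of_isClosed_isBounded (isClosed_piece ch ua ub hfL hfR)
    ((Metric.isBounded_closedBall (x := (0 : ℝ × ℝ)) (r := R)).subset fun p hp => ?_)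
  obtain ⟨hu, h1, h2⟩ := hp
  rw [mem_closedBall, dist_zero_right]
  have hvhi : ch.v p ≤ ML := h2.trans (hML (mem_image_of_mem fL hu))
  have hvlo : mR ≤ ch.v p := (hmR (mem_image_of_mem fR hu)).trans h1
  have habs_u : |ch.u p| ≤ |ua| + |ub| := by
    rw [abs_le]; constructor <;> cases abs_cases ua <;> cases abs_cases ub <;> linarith [hu.1, hu.2]
  have habs_v : |ch.v p| ≤ |ML| + |mR| := by
    rw [abs_le]; constructor <;> cases abs_cases ML <;> cases abs_cases mR <;> linarith
  calc ‖p‖ ≤ C * (|ch.u p| + |ch.v p|) := LinChart.norm_le_of_det_ne hdet p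
    _ ≤ C * ((|ua| + |ub|) + (|ML| + |mR|)) := by gcongr
    _ = R := rfl

/-- **Exit through the far face of a graph-channel piece.** Let `F` be `C¹` on the plane, and let
the piece `K = {u ∈ [u_a, u_b], f_R(u) ≤ v ≤ f_L(u)}` (chart `u = aW + cZ`, `v = bW + dZ`,
`ad − bc ≠ 0`, `f_R < f_L` differentiable) satisfy: the field enters through both walls
(`v̇ − f_L′ u̇ < 0` on the upper wall, `v̇ − f_R′ u̇ > 0` on the lower wall) and `u̇ > 0` on `K`.
Then from every point of `K` with `u < u_b` and `f_R(u) < v < f_L(u)` (the entry face `u = u_a`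
included) the solution of `x′ = F(x)` runs inside `K`, strictly between the walls, until it reaches
the face `u = u_b` at a finite time `T > 0`.
[cite: BuckmasterCaolaboraGomezserrano2025, §3 (proof of Prop. 3.1), §4 (proof of Prop. 4.1)] -/
theorem exists_exit_of_piece {F : ℝ × ℝ → ℝ × ℝ} (hF : ∀ x, ContDiffAt ℝ 1 F x)
    {ch : LinChart} (hdet : ch.a * ch.d - ch.b * ch.c ≠ 0) {ua ub : ℝ} (hab : ua < ub)
    {fL fR fL' fR' : ℝ → ℝ} (hfL : ∀ u, HasDerivAt fL (fL' u) u) (hfR : ∀ u, HasDerivAt fR (fR' u) u)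
    (hwallL : ∀ p : ℝ × ℝ, ch.u p ∈ Icc ua ub → ch.v p = fL (ch.u p) →
      ch.v (F p) - fL' (ch.u p) * ch.u (F p) < 0)
    (hwallR : ∀ p : ℝ × ℝ, ch.u p ∈ Icc ua ub → ch.v p = fR (ch.u p) →
      0 < ch.v (F p) - fR' (ch.u p) * ch.u (F p))
    (hprog : ∀ p ∈ piece ch ua ub fL fR, 0 < ch.u (F p))
    {p₀ : ℝ × ℝ} (hu₀ : ch.u p₀ ∈ Ico ua ub) (hv₀ : fR (ch.u p₀) < ch.v p₀ ∧ ch.v p₀ < fL (ch.u p₀)) :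
    ∃ T > (0 : ℝ), ∃ x : ℝ → ℝ × ℝ, x 0 = p₀ ∧ (∀ t ∈ Icc 0 T, HasDerivAt x (F (x t)) t) ∧
      (∀ t ∈ Icc 0 T, ch.u (x t) ∈ Icc ua ub ∧ fR (ch.u (x t)) < ch.v (x t) ∧
        ch.v (x t) < fL (ch.u (x t))) ∧ ch.u (x T) = ub := by
  have hcL : Continuous fL := continuous_iff_continuousAt.2 fun u => (hfL u).continuousAt
  have hcR : Continuous fR := continuous_iff_continuousAt.2 fun u => (hfR u).continuousAt
  have hK : IsCompact (piece ch ua ub fL fR) := isCompact_piece hdet hcL hcR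
  have hp₀K : p₀ ∈ piece ch ua ub fL fR := ⟨⟨hu₀.1, hu₀.2.le⟩, hv₀.1.le, hv₀.2.le⟩
  -- a positive lower bound `m` of `u̇` on the piece
  have hcuF : Continuous fun p => ch.u (F p) :=
    ch.continuous_u.comp (continuous_iff_continuousAt.2 fun x => (hF x).continuousAt)
  obtain ⟨pm, hpmK, hpm⟩ := hK.exists_isMinOn ⟨p₀, hp₀K⟩ hcuF.continuousOn
  set m := ch.u (F pm) with hm
  have hm0 : 0 < m := hprog pm hpmK
  have hmle : ∀ p ∈ piece ch ua ub fL fR, m ≤ ch.u (F p) := fun p hp => hpm hp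
  -- local solution through `p₀` and its maximal forward continuation
  have hF' : ∀ x ∈ (univ : Set (ℝ × ℝ)), ContDiffAt ℝ 1 F x := fun x _ => hF x
  obtain ⟨α, ε, hε, hα0, hα, -⟩ := exists_solution_mem isOpen_univ hF' (mem_univ p₀) 0
  simp only [zero_sub, zero_add] at hα
  set b₀ : ℝ := (ub - ua) / m + 1 with hb₀
  have hb₀pos : 0 < b₀ := by
    have : 0 < (ub - ua) / m := div_pos (by linarith) hm0
    linarith
  -- package: a solution `x` on `(-ε, Tx)` through `p₀`, with `Tx ≤ b₀ ⇒` escape from `K`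
  obtain ⟨x, Tx, hTx, hx0, hx, hesc⟩ : ∃ x : ℝ → ℝ × ℝ, ∃ Tx : ℝ, 0 < Tx ∧ x 0 = p₀ ∧
      (∀ t ∈ Ioo (-ε) Tx, HasDerivAt x (F (x t)) t) ∧
      (Tx ≤ b₀ → ∃ δ > (0 : ℝ), ∀ t ∈ Ioo (-ε) Tx, Tx - δ < t → x t ∉ piece ch ua ub fL fR) := by
    rcases exists_maximal (U := univ) hF' (show -ε < ε by linarith) hα (fun _ _ => mem_univ _) with
      ⟨c, hce, hcd, -⟩ | ⟨T, hεT, c, hce, hcd, -, hmax⟩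
    · refine ⟨c, b₀ + 1, by linarith, ?_, fun t ht => hcd t ht.1, fun h => absurd h (by linarith)⟩
      rw [hce ⟨by linarith, hε⟩, hα0]
    · refine ⟨c, T, hε.trans_le hεT, ?_, hcd, fun _ => ?_⟩
      · rw [hce ⟨by linarith, hε⟩, hα0]
      · exact eventually_not_mem_of_maximal isOpen_univ hF' hK (subset_univ _) hcd
          (fun _ _ => mem_univ _) (fun c' T' hT' he hd' _ => hmax c' T' hT' he hd' (fun _ _ => mem_univ _))
  -- the clock: `P t := u(x t) < u_b ∧ t < Tx`
  set P : ℝ → Prop := fun t => ch.u (x t) < ub ∧ t < Tx with hP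
  have hP0 : P 0 := ⟨by rw [hx0]; exact hu₀.2, hTx⟩
  set T₁ := maximalTimeP P 0 b₀ with hT₁
  have hT₁mem := maximalTimeP_mem hb₀pos.le hP0
  have hPlt : ∀ t, 0 ≤ t → t < T₁ → P t := fun t h0 ht => maximalTimeP_spec_of_lt hb₀pos.le hP0 h0 ht
  -- trapping: on `[0, t]`, `t < T₁`, the solution stays in the piece
  have hderiv : ∀ t, 0 ≤ t → t < T₁ → HasDerivAt x (F (x t)) t := fun t h0 ht =>
    hx t ⟨by linarith, (hPlt t h0 ht).2⟩
  have htrap : ∀ t, 0 ≤ t → t < T₁ → x t ∈ piece ch ua ub fL fR := by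
    intro t h0 ht
    -- constraints `g₀ = v - fL(u)`, `g₁ = fR(u) - v`, `g₂ = ua - u` on `[0, t']`, `t' = (t + T₁)/2`
    set t' := (t + T₁) / 2 with ht'
    have htt' : t < t' := by rw [ht']; linarith
    have ht'T : t' < T₁ := by rw [ht']; linarith
    have hres := Monatomic.forall_le_zero_of_deriv_neg₃
      (g₀ := fun s => ch.v (x s) - fL (ch.u (x s))) (g₁ := fun s => fR (ch.u (x s)) - ch.v (x s))
      (g₂ := fun s => ua - ch.u (x s))
      (g₀' := fun s => ch.v (F (x s)) - fL' (ch.u (x s)) * ch.u (F (x s)))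
      (g₁' := fun s => fR' (ch.u (x s)) * ch.u (F (x s)) - ch.v (F (x s)))
      (g₂' := fun s => -ch.u (F (x s))) (a := 0) (b := t')
      (fun ξ hξ => (ch.hasDerivAt_v (hderiv ξ hξ.1 (hξ.2.trans ht'T))).sub
        ((hfL _).comp ξ (ch.hasDerivAt_u (hderiv ξ hξ.1 (hξ.2.trans ht'T)))))
      (fun ξ hξ => ((hfR _).comp ξ (ch.hasDerivAt_u (hderiv ξ hξ.1 (hξ.2.trans ht'T)))).sub
        (ch.hasDerivAt_v (hderiv ξ hξ.1 (hξ.2.trans ht'T))))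
      (fun ξ hξ => by simpa using (ch.hasDerivAt_u (hderiv ξ hξ.1 (hξ.2.trans ht'T))).const_sub ua)
      ⟨by simp only [hx0]; linarith [hv₀.2], by simp only [hx0]; linarith [hv₀.1],
        by simp only [hx0]; linarith [hu₀.1]⟩ ?_ t ⟨h0, htt'⟩
    swap
    · intro ξ hξ h0' h1' h2'
      have hub : ch.u (x ξ) < ub := (hPlt ξ hξ.1 (hξ.2.trans ht'T)).1
      have huI : ch.u (x ξ) ∈ Icc ua ub := ⟨by linarith, hub.le⟩
      have hmem : x ξ ∈ piece ch ua ub fL fR := ⟨huI, by linarith, by linarith⟩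
      refine ⟨fun hi => hwallL (x ξ) huI (by linarith), fun hi => ?_, fun _ => ?_⟩
      · have := hwallR (x ξ) huI (by linarith)
        linarith
      · linarith [hprog _ hmem]
    obtain ⟨r0, r1, r2⟩ := hres
    exact ⟨⟨by linarith, (hPlt t h0 ht).1.le⟩, by linarith, by linarith⟩
  -- `u` grows at least at rate `m` on `[0, T₁)`, hence `T₁ ≤ (ub - ua)/m < b₀`
  have hgrow : ∀ t, 0 ≤ t → t < T₁ → ua + m * t ≤ ch.u (x t) := by
    intro t h0 ht
    -- mean-value argument with `Convex.mul_sub_le_image_sub_of_le_deriv`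
    have hdiff : ∀ s ∈ Icc (0 : ℝ) t, HasDerivAt (fun s => ch.u (x s)) (ch.u (F (x s))) s :=
      fun s hs => ch.hasDerivAt_u (hderiv s hs.1 (lt_of_le_of_lt hs.2 ht))
    have hcont : ContinuousOn (fun s => ch.u (x s)) (Icc 0 t) :=
      fun s hs => (hdiff s hs).continuousAt.continuousWithinAt
    have hge : ∀ s ∈ interior (Icc (0 : ℝ) t), m ≤ deriv (fun s => ch.u (x s)) s := by
      intro s hs
      rw [interior_Icc] at hs
      rw [(hdiff s ⟨hs.1.le, hs.2.le⟩).deriv]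
      exact hmle _ (htrap s hs.1.le (hs.2.trans ht))
    have hdiff' : DifferentiableOn ℝ (fun s => ch.u (x s)) (interior (Icc 0 t)) := by
      intro s hs; rw [interior_Icc] at hs
      exact (hdiff s ⟨hs.1.le, hs.2.le⟩).differentiableAt.differentiableWithinAt
    have key := (convex_Icc 0 t).mul_sub_le_image_sub_of_le_deriv hcont hdiff' hge 0
      (left_mem_Icc.2 h0) t (right_mem_Icc.2 h0) h0
    simp only [hx0, sub_zero] at key
    linarith [hu₀.1]
  have hT₁lt : T₁ < b₀ := by
    by_contra hcon
    push Not at hcon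
    -- at `t = (ub - ua)/m < T₁` we would have `u ≥ ub`, contradicting `P t`
    set t := (ub - ua) / m with ht
    have ht0 : 0 ≤ t := (div_pos (by linarith) hm0).le
    have htT : t < T₁ := by
      have : t < b₀ := by rw [hb₀]; linarith
      linarith
    have h1 := hgrow t ht0 htT
    have h2 := (hPlt t ht0 htT).1
    have : m * t = ub - ua := by rw [ht]; field_simp
    linarith
  -- `T₁ < Tx`: otherwise the escape lemma contradicts trapping
  have hT₁Tx : T₁ < Tx := by
    by_contra hcon
    push Not at hcon
    obtain ⟨δ, hδ, hout⟩ := hesc (hcon.trans hT₁lt.le)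
    set t := max 0 (Tx - δ / 2) with ht
    have ht0 : 0 ≤ t := le_max_left _ _
    have htTx : t < Tx := max_lt hTx (by linarith)
    have htT₁ : t < T₁ := lt_of_lt_of_le htTx hcon
    have h1 := htrap t ht0 htT₁
    exact hout t ⟨by linarith, htTx⟩ (by rw [ht]; exact lt_of_lt_of_le (by linarith) (le_max_right _ _)) h1
  -- `0 < T₁`
  have hT₁pos : 0 < T₁ := by
    refine lt_maximalTimeP hb₀pos hP0 ?_
    have hc0 : ContinuousAt (fun t => ch.u (x t)) 0 :=
      (ch.hasDerivAt_u (hx 0 ⟨by linarith, hTx⟩)).continuousAt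
    have hlt0 : (fun t => ch.u (x t)) 0 < ub := by show ch.u (x 0) < ub; rw [hx0]; exact hu₀.2
    have h1 : ∀ᶠ t in 𝓝 (0 : ℝ), ch.u (x t) < ub := hc0.eventually (gt_mem_nhds hlt0)
    have h2 : ∀ᶠ t in 𝓝 (0 : ℝ), t < Tx := gt_mem_nhds hTx
    exact (h1.and h2).filter_mono nhdsWithin_le_nhds
  -- at `T₁` the solution is still defined; `u(x T₁) = ub`
  have hdT₁ : HasDerivAt x (F (x T₁)) T₁ := hx T₁ ⟨by linarith, hT₁Tx⟩
  have hcuT₁ : ContinuousAt (fun t => ch.u (x t)) T₁ := (ch.hasDerivAt_u hdT₁).continuousAt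
  have huT₁ : ch.u (x T₁) = ub := by
    apply le_antisymm
    · -- limit of `u(x t) < ub`, `t → T₁⁻`
      have hlim : Tendsto (fun t => ch.u (x t)) (𝓝[<] T₁) (𝓝 (ch.u (x T₁))) :=
        hcuT₁.tendsto.mono_left nhdsWithin_le_nhds
      have hev : ∀ᶠ t in 𝓝[<] T₁, ch.u (x t) ≤ ub :=
        Filter.eventually_of_mem (Ioo_mem_nhdsLT hT₁pos) fun t ht => (hPlt t ht.1.le ht.2).1.le
      exact le_of_tendsto hlim hev
    · -- the exit principle: `P` fails at times arbitrarily close to `T₁`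
      by_contra hcon
      push Not at hcon
      have hne := not_eventually_of_maximalTimeP_lt hb₀pos.le hP0 hT₁lt
      apply hne
      have h1 : ∀ᶠ t in 𝓝 T₁, ch.u (x t) < ub := hcuT₁.eventually (gt_mem_nhds hcon)
      have h2 : ∀ᶠ t in 𝓝 T₁, t < Tx := gt_mem_nhds hT₁Tx
      exact ((h1.and h2).filter_mono nhdsWithin_le_nhds).mono fun t ht => ⟨ht.1, ht.2⟩
  -- membership at `T₁` by closedness, and strict inequalities everywhere on `[0, T₁]`
  have hmemT₁ : x T₁ ∈ piece ch ua ub fL fR := by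
    have hclosed := isClosed_piece ch ua ub hcL hcR
    have hcx : ContinuousAt x T₁ := hdT₁.continuousAt
    have hlim : Tendsto x (𝓝[<] T₁) (𝓝 (x T₁)) := hcx.tendsto.mono_left nhdsWithin_le_nhds
    have hev : ∀ᶠ t in 𝓝[<] T₁, x t ∈ piece ch ua ub fL fR :=
      Filter.eventually_of_mem (Ioo_mem_nhdsLT hT₁pos) fun t ht => htrap t ht.1.le ht.2
    exact hclosed.mem_of_tendsto hlim hev
  have hmem : ∀ t ∈ Icc 0 T₁, x t ∈ piece ch ua ub fL fR := by
    intro t ht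
    rcases lt_or_eq_of_le ht.2 with h | h
    · exact htrap t ht.1 h
    · rw [h]; exact hmemT₁
  have hderiv' : ∀ t ∈ Icc 0 T₁, HasDerivAt x (F (x t)) t := fun t ht =>
    hx t ⟨by linarith [ht.1], lt_of_le_of_lt ht.2 hT₁Tx⟩
  -- strictness: a wall touched at `t > 0` would have been crossed just before
  have hstrict : ∀ t ∈ Icc 0 T₁, fR (ch.u (x t)) < ch.v (x t) ∧ ch.v (x t) < fL (ch.u (x t)) := by
    intro t ht
    obtain ⟨huI, h1, h2⟩ := hmem t ht
    rcases eq_or_lt_of_le ht.1 with h0 | h0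
    · rw [← h0, hx0]; exact hv₀
    constructor
    · by_contra hcon
      have heq : ch.v (x t) = fR (ch.u (x t)) := le_antisymm (not_lt.1 hcon) h1
      -- `g = fR(u) - v` has `g t = 0`, `g' t < 0`, so `g > 0` just before `t`: contradiction
      have hxd := hderiv' t ht
      have hgd : HasDerivAt (fun s => fR (ch.u (x s)) - ch.v (x s))
          (fR' (ch.u (x t)) * ch.u (F (x t)) - ch.v (F (x t))) t :=
        (((hfR _).comp t (ch.hasDerivAt_u hxd))).sub (ch.hasDerivAt_v hxd)
      have hneg : fR' (ch.u (x t)) * ch.u (F (x t)) - ch.v (F (x t)) < 0 := by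
        linarith [hwallR (x t) huI heq]
      -- derivative from the left: values just before `t` are `> g t = 0`
      have hslope := (hasDerivAt_iff_tendsto_slope.mp hgd)
      have hev : ∀ᶠ s in 𝓝[<] t, slope (fun s => fR (ch.u (x s)) - ch.v (x s)) t s < 0 :=
        ((tendsto_order.1 hslope).2 0 hneg).filter_mono (nhdsWithin_mono t fun s hs => ne_of_lt hs)
      have hev2 : ∀ᶠ s in 𝓝[<] t, s ∈ Ioo 0 t := Filter.eventually_of_mem (Ioo_mem_nhdsLT h0) fun s hs => hs
      obtain ⟨s, hs, hsI⟩ := (hev.and hev2).exists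
      rw [slope_def_field] at hs
      have hst : s - t < 0 := by linarith [hsI.2]
      have hgt0 : fR (ch.u (x t)) - ch.v (x t) = 0 := by linarith
      rw [hgt0, sub_zero] at hs
      have hpos : 0 < fR (ch.u (x s)) - ch.v (x s) := by
        by_contra h'; push Not at h'
        have := div_nonneg_of_nonpos h' hst.le
        linarith
      have := (hmem s ⟨hsI.1.le, hsI.2.le.trans ht.2⟩).2.1
      linarith
    · by_contra hcon
      have heq : ch.v (x t) = fL (ch.u (x t)) := le_antisymm h2 (not_lt.1 hcon)
      have hxd := hderiv' t ht
      have hgd : HasDerivAt (fun s => ch.v (x s) - fL (ch.u (x s)))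
          (ch.v (F (x t)) - fL' (ch.u (x t)) * ch.u (F (x t))) t :=
        (ch.hasDerivAt_v hxd).sub ((hfL _).comp t (ch.hasDerivAt_u hxd))
      have hneg : ch.v (F (x t)) - fL' (ch.u (x t)) * ch.u (F (x t)) < 0 := hwallL (x t) huI heq
      have hslope := (hasDerivAt_iff_tendsto_slope.mp hgd)
      have hev : ∀ᶠ s in 𝓝[<] t, slope (fun s => ch.v (x s) - fL (ch.u (x s))) t s < 0 :=
        ((tendsto_order.1 hslope).2 0 hneg).filter_mono (nhdsWithin_mono t fun s hs => ne_of_lt hs)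
      have hev2 : ∀ᶠ s in 𝓝[<] t, s ∈ Ioo 0 t := Filter.eventually_of_mem (Ioo_mem_nhdsLT h0) fun s hs => hs
      obtain ⟨s, hs, hsI⟩ := (hev.and hev2).exists
      rw [slope_def_field] at hs
      have hst : s - t < 0 := by linarith [hsI.2]
      have hgt0 : ch.v (x t) - fL (ch.u (x t)) = 0 := by linarith
      rw [hgt0, sub_zero] at hs
      have hpos : 0 < ch.v (x s) - fL (ch.u (x s)) := by
        by_contra h'; push Not at h'
        have := div_nonneg_of_nonpos h' hst.le
        linarith
      have := (hmem s ⟨hsI.1.le, hsI.2.le.trans ht.2⟩).2.2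
      linarith
  exact ⟨T₁, hT₁pos, x, hx0, hderiv', fun t ht => ⟨(hmem t ht).1, hstrict t ht⟩, huT₁⟩

/-- **Exit through the far face of a graph-channel piece, field `C¹` on an open set.** Same as
`exists_exit_of_piece`, for a field of class `C¹` on an open set `U` containing the piece (needed for
the near-`P_s` region, whose straightening chart is only locally invertible). Let `F` be `C¹` on the plane, and let
the piece `K = {u ∈ [u_a, u_b], f_R(u) ≤ v ≤ f_L(u)}` (chart `u = aW + cZ`, `v = bW + dZ`,
`ad − bc ≠ 0`, `f_R < f_L` differentiable) satisfy: the field enters through both walls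
(`v̇ − f_L′ u̇ < 0` on the upper wall, `v̇ − f_R′ u̇ > 0` on the lower wall) and `u̇ > 0` on `K`.
Then from every point of `K` with `u < u_b` and `f_R(u) < v < f_L(u)` (the entry face `u = u_a`
included) the solution of `x′ = F(x)` runs inside `K`, strictly between the walls, until it reaches
the face `u = u_b` at a finite time `T > 0`.
[cite: BuckmasterCaolaboraGomezserrano2025, §3 (proof of Prop. 3.1), §4 (proof of Prop. 4.1)] -/
theorem exists_exit_of_piece_of_subset {F : ℝ × ℝ → ℝ × ℝ} {U : Set (ℝ × ℝ)} (hU : IsOpen U)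
    (hF : ∀ x ∈ U, ContDiffAt ℝ 1 F x)
    {ch : LinChart} (hdet : ch.a * ch.d - ch.b * ch.c ≠ 0) {ua ub : ℝ} (hab : ua < ub)
    {fL fR fL' fR' : ℝ → ℝ} (hfL : ∀ u, HasDerivAt fL (fL' u) u) (hfR : ∀ u, HasDerivAt fR (fR' u) u)
    (hwallL : ∀ p : ℝ × ℝ, ch.u p ∈ Icc ua ub → ch.v p = fL (ch.u p) →
      ch.v (F p) - fL' (ch.u p) * ch.u (F p) < 0)
    (hwallR : ∀ p : ℝ × ℝ, ch.u p ∈ Icc ua ub → ch.v p = fR (ch.u p) →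
      0 < ch.v (F p) - fR' (ch.u p) * ch.u (F p))
    (hprog : ∀ p ∈ piece ch ua ub fL fR, 0 < ch.u (F p)) (hKU : piece ch ua ub fL fR ⊆ U)
    {p₀ : ℝ × ℝ} (hu₀ : ch.u p₀ ∈ Ico ua ub) (hv₀ : fR (ch.u p₀) < ch.v p₀ ∧ ch.v p₀ < fL (ch.u p₀)) :
    ∃ T > (0 : ℝ), ∃ x : ℝ → ℝ × ℝ, x 0 = p₀ ∧ (∀ t ∈ Icc 0 T, HasDerivAt x (F (x t)) t) ∧
      (∀ t ∈ Icc 0 T, ch.u (x t) ∈ Icc ua ub ∧ fR (ch.u (x t)) < ch.v (x t) ∧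
        ch.v (x t) < fL (ch.u (x t))) ∧ ch.u (x T) = ub := by
  have hcL : Continuous fL := continuous_iff_continuousAt.2 fun u => (hfL u).continuousAt
  have hcR : Continuous fR := continuous_iff_continuousAt.2 fun u => (hfR u).continuousAt
  have hK : IsCompact (piece ch ua ub fL fR) := isCompact_piece hdet hcL hcR
  have hp₀K : p₀ ∈ piece ch ua ub fL fR := ⟨⟨hu₀.1, hu₀.2.le⟩, hv₀.1.le, hv₀.2.le⟩
  -- a positive lower bound `m` of `u̇` on the piece
  have hcuF : ContinuousOn (fun p => ch.u (F p)) (piece ch ua ub fL fR) := fun p hp =>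
    (ch.continuous_u.continuousAt.comp (hF p (hKU hp)).continuousAt).continuousWithinAt
  obtain ⟨pm, hpmK, hpm⟩ := hK.exists_isMinOn ⟨p₀, hp₀K⟩ hcuF
  set m := ch.u (F pm) with hm
  have hm0 : 0 < m := hprog pm hpmK
  have hmle : ∀ p ∈ piece ch ua ub fL fR, m ≤ ch.u (F p) := fun p hp => hpm hp
  -- local solution through `p₀` and its maximal forward continuation
  obtain ⟨α, ε, hε, hα0, hα, hαU⟩ := exists_solution_mem hU hF (hKU hp₀K) 0
  simp only [zero_sub, zero_add] at hα hαU
  set b₀ : ℝ := (ub - ua) / m + 1 with hb₀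
  have hb₀pos : 0 < b₀ := by
    have : 0 < (ub - ua) / m := div_pos (by linarith) hm0
    linarith
  -- package: a solution `x` on `(-ε, Tx)` through `p₀`, with `Tx ≤ b₀ ⇒` escape from `K`
  obtain ⟨x, Tx, hTx, hx0, hx, hesc⟩ : ∃ x : ℝ → ℝ × ℝ, ∃ Tx : ℝ, 0 < Tx ∧ x 0 = p₀ ∧
      (∀ t ∈ Ioo (-ε) Tx, HasDerivAt x (F (x t)) t) ∧
      (Tx ≤ b₀ → ∃ δ > (0 : ℝ), ∀ t ∈ Ioo (-ε) Tx, Tx - δ < t → x t ∉ piece ch ua ub fL fR) := by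
    rcases exists_maximal (U := U) hF (show -ε < ε by linarith) hα hαU with
      ⟨c, hce, hcd, -⟩ | ⟨T, hεT, c, hce, hcd, hcU, hmax⟩
    · refine ⟨c, b₀ + 1, by linarith, ?_, fun t ht => hcd t ht.1, fun h => absurd h (by linarith)⟩
      rw [hce ⟨by linarith, hε⟩, hα0]
    · refine ⟨c, T, hε.trans_le hεT, ?_, hcd, fun _ => ?_⟩
      · rw [hce ⟨by linarith, hε⟩, hα0]
      · exact eventually_not_mem_of_maximal hU hF hK hKU hcd hcU hmax
  -- the clock: `P t := u(x t) < u_b ∧ t < Tx`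
  set P : ℝ → Prop := fun t => ch.u (x t) < ub ∧ t < Tx with hP
  have hP0 : P 0 := ⟨by rw [hx0]; exact hu₀.2, hTx⟩
  set T₁ := maximalTimeP P 0 b₀ with hT₁
  have hT₁mem := maximalTimeP_mem hb₀pos.le hP0
  have hPlt : ∀ t, 0 ≤ t → t < T₁ → P t := fun t h0 ht => maximalTimeP_spec_of_lt hb₀pos.le hP0 h0 ht
  -- trapping: on `[0, t]`, `t < T₁`, the solution stays in the piece
  have hderiv : ∀ t, 0 ≤ t → t < T₁ → HasDerivAt x (F (x t)) t := fun t h0 ht =>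
    hx t ⟨by linarith, (hPlt t h0 ht).2⟩
  have htrap : ∀ t, 0 ≤ t → t < T₁ → x t ∈ piece ch ua ub fL fR := by
    intro t h0 ht
    -- constraints `g₀ = v - fL(u)`, `g₁ = fR(u) - v`, `g₂ = ua - u` on `[0, t']`, `t' = (t + T₁)/2`
    set t' := (t + T₁) / 2 with ht'
    have htt' : t < t' := by rw [ht']; linarith
    have ht'T : t' < T₁ := by rw [ht']; linarith
    have hres := Monatomic.forall_le_zero_of_deriv_neg₃
      (g₀ := fun s => ch.v (x s) - fL (ch.u (x s))) (g₁ := fun s => fR (ch.u (x s)) - ch.v (x s))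
      (g₂ := fun s => ua - ch.u (x s))
      (g₀' := fun s => ch.v (F (x s)) - fL' (ch.u (x s)) * ch.u (F (x s)))
      (g₁' := fun s => fR' (ch.u (x s)) * ch.u (F (x s)) - ch.v (F (x s)))
      (g₂' := fun s => -ch.u (F (x s))) (a := 0) (b := t')
      (fun ξ hξ => (ch.hasDerivAt_v (hderiv ξ hξ.1 (hξ.2.trans ht'T))).sub
        ((hfL _).comp ξ (ch.hasDerivAt_u (hderiv ξ hξ.1 (hξ.2.trans ht'T)))))
      (fun ξ hξ => ((hfR _).comp ξ (ch.hasDerivAt_u (hderiv ξ hξ.1 (hξ.2.trans ht'T)))).sub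
        (ch.hasDerivAt_v (hderiv ξ hξ.1 (hξ.2.trans ht'T))))
      (fun ξ hξ => by simpa using (ch.hasDerivAt_u (hderiv ξ hξ.1 (hξ.2.trans ht'T))).const_sub ua)
      ⟨by simp only [hx0]; linarith [hv₀.2], by simp only [hx0]; linarith [hv₀.1],
        by simp only [hx0]; linarith [hu₀.1]⟩ ?_ t ⟨h0, htt'⟩
    swap
    · intro ξ hξ h0' h1' h2'
      have hub : ch.u (x ξ) < ub := (hPlt ξ hξ.1 (hξ.2.trans ht'T)).1
      have huI : ch.u (x ξ) ∈ Icc ua ub := ⟨by linarith, hub.le⟩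
      have hmem : x ξ ∈ piece ch ua ub fL fR := ⟨huI, by linarith, by linarith⟩
      refine ⟨fun hi => hwallL (x ξ) huI (by linarith), fun hi => ?_, fun _ => ?_⟩
      · have := hwallR (x ξ) huI (by linarith)
        linarith
      · linarith [hprog _ hmem]
    obtain ⟨r0, r1, r2⟩ := hres
    exact ⟨⟨by linarith, (hPlt t h0 ht).1.le⟩, by linarith, by linarith⟩
  -- `u` grows at least at rate `m` on `[0, T₁)`, hence `T₁ ≤ (ub - ua)/m < b₀`
  have hgrow : ∀ t, 0 ≤ t → t < T₁ → ua + m * t ≤ ch.u (x t) := by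
    intro t h0 ht
    -- mean-value argument with `Convex.mul_sub_le_image_sub_of_le_deriv`
    have hdiff : ∀ s ∈ Icc (0 : ℝ) t, HasDerivAt (fun s => ch.u (x s)) (ch.u (F (x s))) s :=
      fun s hs => ch.hasDerivAt_u (hderiv s hs.1 (lt_of_le_of_lt hs.2 ht))
    have hcont : ContinuousOn (fun s => ch.u (x s)) (Icc 0 t) :=
      fun s hs => (hdiff s hs).continuousAt.continuousWithinAt
    have hge : ∀ s ∈ interior (Icc (0 : ℝ) t), m ≤ deriv (fun s => ch.u (x s)) s := by
      intro s hs
      rw [interior_Icc] at hs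
      rw [(hdiff s ⟨hs.1.le, hs.2.le⟩).deriv]
      exact hmle _ (htrap s hs.1.le (hs.2.trans ht))
    have hdiff' : DifferentiableOn ℝ (fun s => ch.u (x s)) (interior (Icc 0 t)) := by
      intro s hs; rw [interior_Icc] at hs
      exact (hdiff s ⟨hs.1.le, hs.2.le⟩).differentiableAt.differentiableWithinAt
    have key := (convex_Icc 0 t).mul_sub_le_image_sub_of_le_deriv hcont hdiff' hge 0
      (left_mem_Icc.2 h0) t (right_mem_Icc.2 h0) h0
    simp only [hx0, sub_zero] at key
    linarith [hu₀.1]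
  have hT₁lt : T₁ < b₀ := by
    by_contra hcon
    push Not at hcon
    -- at `t = (ub - ua)/m < T₁` we would have `u ≥ ub`, contradicting `P t`
    set t := (ub - ua) / m with ht
    have ht0 : 0 ≤ t := (div_pos (by linarith) hm0).le
    have htT : t < T₁ := by
      have : t < b₀ := by rw [hb₀]; linarith
      linarith
    have h1 := hgrow t ht0 htT
    have h2 := (hPlt t ht0 htT).1
    have : m * t = ub - ua := by rw [ht]; field_simp
    linarith
  -- `T₁ < Tx`: otherwise the escape lemma contradicts trapping
  have hT₁Tx : T₁ < Tx := by
    by_contra hcon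
    push Not at hcon
    obtain ⟨δ, hδ, hout⟩ := hesc (hcon.trans hT₁lt.le)
    set t := max 0 (Tx - δ / 2) with ht
    have ht0 : 0 ≤ t := le_max_left _ _
    have htTx : t < Tx := max_lt hTx (by linarith)
    have htT₁ : t < T₁ := lt_of_lt_of_le htTx hcon
    have h1 := htrap t ht0 htT₁
    exact hout t ⟨by linarith, htTx⟩ (by rw [ht]; exact lt_of_lt_of_le (by linarith) (le_max_right _ _)) h1
  -- `0 < T₁`
  have hT₁pos : 0 < T₁ := by
    refine lt_maximalTimeP hb₀pos hP0 ?_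
    have hc0 : ContinuousAt (fun t => ch.u (x t)) 0 :=
      (ch.hasDerivAt_u (hx 0 ⟨by linarith, hTx⟩)).continuousAt
    have hlt0 : (fun t => ch.u (x t)) 0 < ub := by show ch.u (x 0) < ub; rw [hx0]; exact hu₀.2
    have h1 : ∀ᶠ t in 𝓝 (0 : ℝ), ch.u (x t) < ub := hc0.eventually (gt_mem_nhds hlt0)
    have h2 : ∀ᶠ t in 𝓝 (0 : ℝ), t < Tx := gt_mem_nhds hTx
    exact (h1.and h2).filter_mono nhdsWithin_le_nhds
  -- at `T₁` the solution is still defined; `u(x T₁) = ub`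
  have hdT₁ : HasDerivAt x (F (x T₁)) T₁ := hx T₁ ⟨by linarith, hT₁Tx⟩
  have hcuT₁ : ContinuousAt (fun t => ch.u (x t)) T₁ := (ch.hasDerivAt_u hdT₁).continuousAt
  have huT₁ : ch.u (x T₁) = ub := by
    apply le_antisymm
    · -- limit of `u(x t) < ub`, `t → T₁⁻`
      have hlim : Tendsto (fun t => ch.u (x t)) (𝓝[<] T₁) (𝓝 (ch.u (x T₁))) :=
        hcuT₁.tendsto.mono_left nhdsWithin_le_nhds
      have hev : ∀ᶠ t in 𝓝[<] T₁, ch.u (x t) ≤ ub :=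
        Filter.eventually_of_mem (Ioo_mem_nhdsLT hT₁pos) fun t ht => (hPlt t ht.1.le ht.2).1.le
      exact le_of_tendsto hlim hev
    · -- the exit principle: `P` fails at times arbitrarily close to `T₁`
      by_contra hcon
      push Not at hcon
      have hne := not_eventually_of_maximalTimeP_lt hb₀pos.le hP0 hT₁lt
      apply hne
      have h1 : ∀ᶠ t in 𝓝 T₁, ch.u (x t) < ub := hcuT₁.eventually (gt_mem_nhds hcon)
      have h2 : ∀ᶠ t in 𝓝 T₁, t < Tx := gt_mem_nhds hT₁Tx
      exact ((h1.and h2).filter_mono nhdsWithin_le_nhds).mono fun t ht => ⟨ht.1, ht.2⟩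
  -- membership at `T₁` by closedness, and strict inequalities everywhere on `[0, T₁]`
  have hmemT₁ : x T₁ ∈ piece ch ua ub fL fR := by
    have hclosed := isClosed_piece ch ua ub hcL hcR
    have hcx : ContinuousAt x T₁ := hdT₁.continuousAt
    have hlim : Tendsto x (𝓝[<] T₁) (𝓝 (x T₁)) := hcx.tendsto.mono_left nhdsWithin_le_nhds
    have hev : ∀ᶠ t in 𝓝[<] T₁, x t ∈ piece ch ua ub fL fR :=
      Filter.eventually_of_mem (Ioo_mem_nhdsLT hT₁pos) fun t ht => htrap t ht.1.le ht.2
    exact hclosed.mem_of_tendsto hlim hev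
  have hmem : ∀ t ∈ Icc 0 T₁, x t ∈ piece ch ua ub fL fR := by
    intro t ht
    rcases lt_or_eq_of_le ht.2 with h | h
    · exact htrap t ht.1 h
    · rw [h]; exact hmemT₁
  have hderiv' : ∀ t ∈ Icc 0 T₁, HasDerivAt x (F (x t)) t := fun t ht =>
    hx t ⟨by linarith [ht.1], lt_of_le_of_lt ht.2 hT₁Tx⟩
  -- strictness: a wall touched at `t > 0` would have been crossed just before
  have hstrict : ∀ t ∈ Icc 0 T₁, fR (ch.u (x t)) < ch.v (x t) ∧ ch.v (x t) < fL (ch.u (x t)) := by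
    intro t ht
    obtain ⟨huI, h1, h2⟩ := hmem t ht
    rcases eq_or_lt_of_le ht.1 with h0 | h0
    · rw [← h0, hx0]; exact hv₀
    constructor
    · by_contra hcon
      have heq : ch.v (x t) = fR (ch.u (x t)) := le_antisymm (not_lt.1 hcon) h1
      -- `g = fR(u) - v` has `g t = 0`, `g' t < 0`, so `g > 0` just before `t`: contradiction
      have hxd := hderiv' t ht
      have hgd : HasDerivAt (fun s => fR (ch.u (x s)) - ch.v (x s))
          (fR' (ch.u (x t)) * ch.u (F (x t)) - ch.v (F (x t))) t :=
        (((hfR _).comp t (ch.hasDerivAt_u hxd))).sub (ch.hasDerivAt_v hxd)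
      have hneg : fR' (ch.u (x t)) * ch.u (F (x t)) - ch.v (F (x t)) < 0 := by
        linarith [hwallR (x t) huI heq]
      -- derivative from the left: values just before `t` are `> g t = 0`
      have hslope := (hasDerivAt_iff_tendsto_slope.mp hgd)
      have hev : ∀ᶠ s in 𝓝[<] t, slope (fun s => fR (ch.u (x s)) - ch.v (x s)) t s < 0 :=
        ((tendsto_order.1 hslope).2 0 hneg).filter_mono (nhdsWithin_mono t fun s hs => ne_of_lt hs)
      have hev2 : ∀ᶠ s in 𝓝[<] t, s ∈ Ioo 0 t := Filter.eventually_of_mem (Ioo_mem_nhdsLT h0) fun s hs => hs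
      obtain ⟨s, hs, hsI⟩ := (hev.and hev2).exists
      rw [slope_def_field] at hs
      have hst : s - t < 0 := by linarith [hsI.2]
      have hgt0 : fR (ch.u (x t)) - ch.v (x t) = 0 := by linarith
      rw [hgt0, sub_zero] at hs
      have hpos : 0 < fR (ch.u (x s)) - ch.v (x s) := by
        by_contra h'; push Not at h'
        have := div_nonneg_of_nonpos h' hst.le
        linarith
      have := (hmem s ⟨hsI.1.le, hsI.2.le.trans ht.2⟩).2.1
      linarith
    · by_contra hcon
      have heq : ch.v (x t) = fL (ch.u (x t)) := le_antisymm h2 (not_lt.1 hcon)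
      have hxd := hderiv' t ht
      have hgd : HasDerivAt (fun s => ch.v (x s) - fL (ch.u (x s)))
          (ch.v (F (x t)) - fL' (ch.u (x t)) * ch.u (F (x t))) t :=
        (ch.hasDerivAt_v hxd).sub ((hfL _).comp t (ch.hasDerivAt_u hxd))
      have hneg : ch.v (F (x t)) - fL' (ch.u (x t)) * ch.u (F (x t)) < 0 := hwallL (x t) huI heq
      have hslope := (hasDerivAt_iff_tendsto_slope.mp hgd)
      have hev : ∀ᶠ s in 𝓝[<] t, slope (fun s => ch.v (x s) - fL (ch.u (x s))) t s < 0 :=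
        ((tendsto_order.1 hslope).2 0 hneg).filter_mono (nhdsWithin_mono t fun s hs => ne_of_lt hs)
      have hev2 : ∀ᶠ s in 𝓝[<] t, s ∈ Ioo 0 t := Filter.eventually_of_mem (Ioo_mem_nhdsLT h0) fun s hs => hs
      obtain ⟨s, hs, hsI⟩ := (hev.and hev2).exists
      rw [slope_def_field] at hs
      have hst : s - t < 0 := by linarith [hsI.2]
      have hgt0 : ch.v (x t) - fL (ch.u (x t)) = 0 := by linarith
      rw [hgt0, sub_zero] at hs
      have hpos : 0 < ch.v (x s) - fL (ch.u (x s)) := by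
        by_contra h'; push Not at h'
        have := div_nonneg_of_nonpos h' hst.le
        linarith
      have := (hmem s ⟨hsI.1.le, hsI.2.le.trans ht.2⟩).2.2
      linarith
  exact ⟨T₁, hT₁pos, x, hx0, hderiv', fun t ht => ⟨(hmem t ht).1, hstrict t ht⟩, huT₁⟩

end ODE

end BuckmasterCaolaboraGomezserrano2025

end Literature.Analysis.FluidPDE
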